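import Summits.QuantumFields.BalabanUV.Beta.CompositeHessianTable
import Summits.QuantumFields.BalabanUV.Beta.BorderedHessianSymmetry
import Summits.QuantumFields.BalabanUV.Beta.TameKernelCalculus

/-!
# `BalabanUV.Beta.CompositeTablesParity` — row D1 ∕ (C1), file F6g (brick-generic): THE ROW PARITIES (V-p) and (H-p) OF THE COMPOSITE TABLES —
# `trK = −sgnK` for the packed composite border family `compVhS` (fm∕mf support + node 7a's packer symmetry) and for the composite Hessian table
# `compHessFF` (ff support + antisymmetry), the composite twins of `SymTablesAn1FirstOrder.trK_symVhSAt ∕ trK_symHessFFAt` (leaf-05's parity calculus)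

[folklore] case splits BY NAME over F3's `compVhS` (`packVH_symm`) and F6a's `compHessFF_antisymm`; no def; nothing of Bałaban's asserted, valued or discharged; 0 estimates;
0∕4 row-D1 binders; NOT (C1), NOT D1, NEVER «G-an2-4 closed», NOT BetaPertH, NOT continuum, NOT Clay.  WHY: the record's hW∕hR table letters read (V-p)(H-p)(M-H) of its `SymTables`
(`SymTablesAn1FirstOrder` §1); the composite record (F6, either design) needs the same of its tables — here for every brick set at once.

HONEST DEPENDENCY (page 1, mandatory): continuum YM on T⁴ ⇐ BetaPertH ∧ nine spine estimates (0/9 proved); BetaPertH ⇐ (D1) ∧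
(D4) ∧ CAP+tail; G-an2-4 gates asym, D1 and NE2/3/4.  Row D1 ∕ (C1) OWNER an2, gen 51, 2026-08-23.  No existing file touched.
-/

noncomputable section

namespace Summit.QuantumFields.BalabanUV.Beta.CompositeTablesParity

open Literature.MathematicalPhysics.QuantumFieldTheory.Balaban1983to89
open Literature.MathematicalPhysics.QuantumFieldTheory.Balaban1983to89.Beta
open AffineAveraging (Site box toSite)
open AveragingHessianKernels (Bond packVH packVH_symm)
open AveragingHessianKernelsRooted (linKerAt vhKerAt hessKerAt)
open SymAveragingHessianCounts (symLinKerAt symVhKerAt symHessKerAt)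
open ExpKernelCalculus (MKer)
open OneStepResolventKernel (Fib)
open Summit.QuantumFields.BalabanUV.Beta.TameKernelCalculus (trK trK_apply)
open Summit.QuantumFields.BalabanUV.Beta.BorderedHessian (sgnF sgnF_inl sgnF_inr sgnK sgnK_apply)
open Summit.QuantumFields.BalabanUV.Beta.CompositeVertexKernelRec (compVHKer compVhS)
open Summit.QuantumFields.BalabanUV.Beta.CompositeHessianTable (compHessFF compHessFF_antisymm compHessFF_inl_inl compHessFF_rooted_antisymm
  compHessFF_sym_antisymm packFF_inl_inr packFF_inr)

variable {d : ℕ}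
variable {ℓ : ℕ → Fin (d + 1) → Site (d + 1) → Bond (d + 1) → ℝ}
  {𝓋 𝒽 : ℕ → Fin (d + 1) → Site (d + 1) → Bond (d + 1) → Bond (d + 1) → ℝ} {L : ℕ}

/-! ## §1 (V-p): the packed composite border family is row-parity-odd -/

/-- [folklore] The packed composite border family is SYMMETRIC (node 7a's packer). -/
theorem compVhS_symm (m : ℕ) (κ : Fin (d + 1)) (u x z : Site (d + 1)) (a b : Fib d) :
    compVhS ℓ 𝓋 L m κ u x z a b = compVhS ℓ 𝓋 L m κ u z x b a := by
  unfold compVhS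
  exact packVH_symm _ _ κ u x z a b

/-- [folklore] **(V-p) FOR THE COMPOSITE BORDER FAMILY, ANY BRICKS**: `trK (compVhS … m κ u) = −sgnK (compVhS … m κ u)` (fm∕mf support + symmetry —
leaf-05's `trK_vhSAt` one storey up). -/
theorem trK_compVhS (m : ℕ) (κ : Fin (d + 1)) (u : Site (d + 1)) :
    trK (compVhS ℓ 𝓋 L m κ u) = -sgnK (compVhS ℓ 𝓋 L m κ u) := by
  funext x z a b
  simp only [trK_apply, Pi.neg_apply, sgnK_apply]
  rw [← compVhS_symm m κ u x z a b]
  rcases a with α | μ <;> rcases b with β | ν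
  · show (0 : ℝ) = -(sgnF (d := d) (Sum.inl α) * sgnF (d := d) (Sum.inl β) * 0)
    simp
  · simp only [sgnF_inl, sgnF_inr]
    ring
  · simp only [sgnF_inl, sgnF_inr]
    ring
  · show (0 : ℝ) = -(sgnF (d := d) (Sum.inr μ) * sgnF (d := d) (Sum.inr ν) * 0)
    simp

/-! ## §2 (H-p): the composite Hessian table is row-parity-odd for an antisymmetric brick -/

/-- [folklore] The composite Hessian table vanishes on `(inl, inr)` (F6a's packer; `rfl`). -/
@[simp] theorem compHessFF_inl_inr (m : ℕ) (μ : Fin (d + 1)) (y x x' : Site (d + 1)) (α μ' : Fin (d + 1)) :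
    compHessFF ℓ 𝒽 L m μ y x x' (Sum.inl α) (Sum.inr μ') = 0 := rfl

/-- [folklore] The composite Hessian table vanishes on `(inr, ·)` (F6a's packer). -/
@[simp] theorem compHessFF_inr (m : ℕ) (μ : Fin (d + 1)) (y x x' : Site (d + 1)) (μ' : Fin (d + 1)) (b : Fib d) :
    compHessFF ℓ 𝒽 L m μ y x x' (Sum.inr μ') b = 0 := by cases b <;> rfl

/-- [folklore] **(H-p) FOR THE COMPOSITE HESSIAN TABLE**: an antisymmetric Hessian brick gives `trK (compHessFF … m μ y) = −sgnK (compHessFF … m μ y)` (ff support +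
F6a's `compHessFF_antisymm` — leaf-05's `trK_hessFFAt` one storey up). -/
theorem trK_compHessFF (h𝒽 : ∀ m μ y f f', 𝒽 m μ y f' f = -𝒽 m μ y f f') (m : ℕ) (μ : Fin (d + 1)) (y : Site (d + 1)) :
    trK (compHessFF ℓ 𝒽 L m μ y) = -sgnK (compHessFF ℓ 𝒽 L m μ y) := by
  funext x z a b
  simp only [trK_apply, Pi.neg_apply, sgnK_apply]
  rw [compHessFF_antisymm h𝒽 m μ y x z a b]
  rcases a with α | ν <;> rcases b with β | ν' <;> simp

/-! ## §3 The two instantiations by name -/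

/-- [folklore] (R) (V-p) for the rooted composite border family. -/
theorem trK_compVhS_rooted {r : ℕ → (Fin (d + 1) → ℕ)} (m : ℕ) (κ : Fin (d + 1)) (u : Site (d + 1)) :
    trK (compVhS (fun m => linKerAt (toSite (r m)) L) (fun m => vhKerAt (toSite (r m)) L) L m κ u)
      = -sgnK (compVhS (fun m => linKerAt (toSite (r m)) L) (fun m => vhKerAt (toSite (r m)) L) L m κ u) :=
  trK_compVhS m κ u

/-- [folklore] (R) (H-p) for the rooted composite Hessian table (an1's `hessKerAt_swap`). -/
theorem trK_compHessFF_rooted {r : ℕ → (Fin (d + 1) → ℕ)} (m : ℕ) (μ : Fin (d + 1)) (y : Site (d + 1)) :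
    trK (compHessFF (fun m => linKerAt (toSite (r m)) L) (fun m => hessKerAt (toSite (r m)) L) L m μ y)
      = -sgnK (compHessFF (fun m => linKerAt (toSite (r m)) L) (fun m => hessKerAt (toSite (r m)) L) L m μ y) :=
  trK_compHessFF (ℓ := fun m => linKerAt (toSite (r m)) L) (𝒽 := fun m => hessKerAt (toSite (r m)) L)
    (fun m μ y f f' => AveragingHessianKernelsRooted.hessKerAt_swap (toSite (r m)) L μ y f f') m μ y

/-- [folklore] (S) (V-p) for the symmetrised composite border family. -/
theorem trK_compVhS_sym {r : Fin (d + 1) → ℕ} (m : ℕ) (κ : Fin (d + 1)) (u : Site (d + 1)) :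
    trK (compVhS (fun _ => symLinKerAt (toSite r) L) (fun _ => symVhKerAt (toSite r) L) L m κ u)
      = -sgnK (compVhS (fun _ => symLinKerAt (toSite r) L) (fun _ => symVhKerAt (toSite r) L) L m κ u) :=
  trK_compVhS m κ u

/-- [folklore] (S) (H-p) for the symmetrised composite Hessian table (an1's `symHessKerAt_swap`). -/
theorem trK_compHessFF_sym {r : Fin (d + 1) → ℕ} (m : ℕ) (μ : Fin (d + 1)) (y : Site (d + 1)) :
    trK (compHessFF (fun _ => symLinKerAt (toSite r) L) (fun _ => symHessKerAt (toSite r) L) L m μ y)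
      = -sgnK (compHessFF (fun _ => symLinKerAt (toSite r) L) (fun _ => symHessKerAt (toSite r) L) L m μ y) :=
  trK_compHessFF (ℓ := fun _ => symLinKerAt (toSite r) L) (𝒽 := fun _ => symHessKerAt (toSite r) L)
    (fun _ μ y f f' => SymAveragingHessianCounts.symHessKerAt_swap (toSite r) L μ y f f') m μ y

end Summit.QuantumFields.BalabanUV.Beta.CompositeTablesParity

end
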